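import Summits.Parity.GeneralizedHardyLittlewood.Theorems.LeeYangFibresRelativeDimOneMoebiusSplitSingularSeriesAux7
import Literature.NumberTheory.Sieve.CoprimeSquarefreeSums
import Literature.NumberTheory.LFunctions.MertensElementary
import HarnessLib

/-!
# Crux `RelativeDimOne` (stmt-Parity-14113), line `single-moebius-split`, stub `stub_tssInduction`:
# auxiliary file 8 — the divisor-type sum carrying the inner error terms

Induction step `t → t + 1` of `TSSInduction`, part 3. The error of the inner `t`-variable sum at the peeled
variable `x` (frozen set `P ∪ pf(x)`) carries the extra factor `∏_{p ∣ x, p ∉ P} Λ |W^{(x)}_p|/p ≤ ∏_{p∣x, p∉P} Λ/p`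
(`Λ ≥ κ_t`); summed over square-free `x ≤ N` this is a nonnegative multiplicative function under its Euler
product, bounded with Mertens' explicit `∑_{p ≤ N} 1/p ≤ log log N + 4`:

* `tssI_sum_frozen_weights` (registered): `∑_{x ≤ N} |μ(x)| Λ^{#(pf x ∖ P)} ∏_{p∣x, p∉P} 1/p ≤ 2^{|P|} e^{4Λ} (log N)^Λ`;
* bookkeeping of the enlarged frozen set `P ∪ pf(x)`: `∏_{P ∪ pf x} p ≤ (∏_P p) x`, its cardinality and products
  split along `P` and `pf(x) ∖ P`, and `∏_{j > ι i} R_j = R_t ∏_{j > i} R_{ι j}` on `Fin (t+1)` (staggering of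
  the restricted levels).

References: D. A. Goldston, C. Y. Yıldırım, Integers 3 (2003) A5 = arXiv:math/0111212, §3 [GoldstonYildirim2001];
G. H. Hardy, E. M. Wright, An Introduction to the Theory of Numbers, Thm 427 [HardyWright2008].
-/

noncomputable section

open Finset Real ArithmeticFunction
open scoped BigOperators ArithmeticFunction.Moebius

namespace Summit.Parity.GeneralizedHardyLittlewood.Cruxes.RelativeDimOne.SingleMoebiusSplit

namespace TSSInd

open Literature.NumberTheory.Sieve

/-! ### The enlarged frozen set `P ∪ pf(x)` -/

/-- `∏_{p ∈ P ∪ pf(x)} p ≤ (∏_{p∈P} p) · x` for `x ≠ 0`. [folklore] -/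
theorem prod_union_primeFactors_le (P : Finset ℕ) {x : ℕ} (hx : x ≠ 0) :
    (∏ p ∈ P ∪ x.primeFactors, (p : ℝ)) ≤ (∏ p ∈ P, (p : ℝ)) * x := by
  rw [← Finset.union_sdiff_self_eq_union, Finset.prod_union Finset.disjoint_sdiff]
  refine mul_le_mul_of_nonneg_left ?_ (Finset.prod_nonneg fun p _ => Nat.cast_nonneg p)
  calc ∏ p ∈ x.primeFactors \ P, (p : ℝ) ≤ ∏ p ∈ x.primeFactors, (p : ℝ) :=
        prod_le_prod_of_subset Finset.sdiff_subset (fun p _ => Nat.cast_nonneg p) fun p hp _ => by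
          exact_mod_cast (Nat.prime_of_mem_primeFactors hp).one_lt.le
    _ ≤ x := by
        rw [← Nat.cast_prod]
        exact_mod_cast Nat.le_of_dvd (Nat.pos_of_ne_zero hx) (Nat.prod_primeFactors_dvd x)

/-- `|P ∪ pf(x)| = |P| + |pf(x) ∖ P|`. [folklore] -/
theorem card_union_primeFactors (P : Finset ℕ) (x : ℕ) :
    (P ∪ x.primeFactors).card = P.card + (x.primeFactors \ P).card := by
  rw [← Finset.union_sdiff_self_eq_union, Finset.card_union_of_disjoint Finset.disjoint_sdiff]

/-- `∏_{P ∪ pf(x)} f = ∏_P f · ∏_{pf(x) ∖ P} f`. [folklore] -/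
theorem prod_union_primeFactors_eq (P : Finset ℕ) (x : ℕ) (f : ℕ → ℝ) :
    ∏ p ∈ P ∪ x.primeFactors, f p = (∏ p ∈ P, f p) * ∏ p ∈ x.primeFactors \ P, f p := by
  rw [← Finset.union_sdiff_self_eq_union, Finset.prod_union Finset.disjoint_sdiff]

/-- The staggered levels restricted to the first `t` indices: `∏_{j > ι i} R_j = R_t · ∏_{j > i} R_{ι j}` on
`Fin (t + 1)`. [folklore] -/
theorem prod_Ioi_castSucc {t : ℕ} (f : Fin (t + 1) → ℝ) (i : Fin t) :
    ∏ j ∈ Finset.Ioi (Fin.castSucc i), f j = f (Fin.last t) * ∏ j ∈ Finset.Ioi i, f (Fin.castSucc j) := by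
  have h : Finset.Ioi (Fin.castSucc i) = insert (Fin.last t) ((Finset.Ioi i).map Fin.castSuccEmb) := by
    ext j
    refine Fin.lastCases ?_ (fun k => ?_) j
    · simp only [Finset.mem_Ioi, Finset.mem_insert, true_or, iff_true]
      exact Fin.castSucc_lt_last i
    · simp only [Finset.mem_Ioi, Finset.mem_insert, Finset.mem_map, Fin.castSuccEmb_apply,
        Fin.castSucc_lt_castSucc_iff]
      constructor
      · intro hk
        exact Or.inr ⟨k, hk, rfl⟩
      · rintro (hk | ⟨k', hk', hkk'⟩)
        · exact absurd hk (Fin.castSucc_lt_last k).ne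
        · rwa [← Fin.castSucc_injective _ hkk']
  have hnot : Fin.last t ∉ (Finset.Ioi i).map Fin.castSuccEmb := by
    simp only [Finset.mem_map, Fin.castSuccEmb_apply, not_exists, not_and]
    exact fun k _ hk => (Fin.castSucc_lt_last k).ne hk
  rw [h, Finset.prod_insert hnot, Finset.prod_map]
  rfl

/-- Staggering of the restricted levels against the enlarged frozen set: if
`(∏_P p)³ (∏_{j>i} R_j)³ ≤ R_i²` for all `i ≤ t` and `1 ≤ x ≤ R_t`, then
`(∏_{P ∪ pf x} p)³ (∏_{j>i} R_{ι j})³ ≤ R_{ι i}²` for all `i < t`. [folklore] -/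
theorem stagger_cond {t : ℕ} (P : Finset ℕ) (R : Fin (t + 1) → ℝ) {x : ℕ} (hx : x ≠ 0)
    (hxR : (x : ℝ) ≤ R (Fin.last t)) (hR0 : ∀ i, 0 ≤ R i)
    (hstag : ∀ i : Fin (t + 1), (∏ p ∈ P, (p : ℝ)) ^ 3 * (∏ j ∈ Finset.Ioi i, R j) ^ 3 ≤ R i ^ 2)
    (i : Fin t) :
    (∏ p ∈ P ∪ x.primeFactors, (p : ℝ)) ^ 3 * (∏ j ∈ Finset.Ioi i, R (Fin.castSucc j)) ^ 3 ≤
      R (Fin.castSucc i) ^ 2 := by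
  have h := hstag (Fin.castSucc i)
  rw [prod_Ioi_castSucc] at h
  refine le_trans ?_ h
  have hP0 : 0 ≤ ∏ p ∈ P, (p : ℝ) := Finset.prod_nonneg fun p _ => Nat.cast_nonneg p
  have hI0 : 0 ≤ ∏ j ∈ Finset.Ioi i, R (Fin.castSucc j) := Finset.prod_nonneg fun j _ => hR0 _
  have h1 : (∏ p ∈ P ∪ x.primeFactors, (p : ℝ)) ≤ (∏ p ∈ P, (p : ℝ)) * R (Fin.last t) :=
    (prod_union_primeFactors_le P hx).trans (mul_le_mul_of_nonneg_left hxR hP0)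
  have h0 : 0 ≤ ∏ p ∈ P ∪ x.primeFactors, (p : ℝ) := Finset.prod_nonneg fun p _ => Nat.cast_nonneg p
  calc (∏ p ∈ P ∪ x.primeFactors, (p : ℝ)) ^ 3 * (∏ j ∈ Finset.Ioi i, R (Fin.castSucc j)) ^ 3
      ≤ ((∏ p ∈ P, (p : ℝ)) * R (Fin.last t)) ^ 3 * (∏ j ∈ Finset.Ioi i, R (Fin.castSucc j)) ^ 3 :=
        mul_le_mul_of_nonneg_right (pow_le_pow_left₀ h0 h1 3) (pow_nonneg hI0 3)
    _ = (∏ p ∈ P, (p : ℝ)) ^ 3 * (R (Fin.last t) * ∏ j ∈ Finset.Ioi i, R (Fin.castSucc j)) ^ 3 := by ring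

/-! ### The conditioned windows on the enlarged frozen set -/

/-- `∏_{p ∈ P ∪ pf x} |W^{(x)}_p|/p ≤ (∏_{p∈P} |W_p|/p) · ∏_{p ∈ pf x ∖ P} 1/p` when the window is full with
`|Z_{p,t}| ≤ 1` off `P`. [folklore] -/
theorem prod_cond_window_le {t : ℕ} (W : ℕ → Finset ℕ) (Z : ℕ → Fin (t + 1) → Finset ℕ) (P : Finset ℕ)
    (x : ℕ) (hZ : ∀ p ∈ x.primeFactors \ P, (Z p (Fin.last t)).card ≤ 1) :
    ∏ p ∈ P ∪ x.primeFactors,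
        (((((fun q => if q ∣ x then (W q).filter (fun r => r ∈ Z q (Fin.last t)) else W q) p).card : ℕ) : ℝ) / p) ≤
      (∏ p ∈ P, ((((W p).card : ℕ) : ℝ) / p)) * ∏ p ∈ x.primeFactors \ P, (1 : ℝ) / p := by
  rw [prod_union_primeFactors_eq]
  have h0 : ∀ q : ℕ, ∀ s : Finset ℕ, (0 : ℝ) ≤ (((s.card : ℕ) : ℝ) / q) := fun q s =>
    div_nonneg (Nat.cast_nonneg _) (Nat.cast_nonneg _)
  refine mul_le_mul (Finset.prod_le_prod (fun p _ => h0 _ _) fun p _ => ?_)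
    (Finset.prod_le_prod (fun p _ => h0 _ _) fun p hp => ?_) (Finset.prod_nonneg fun p _ => h0 _ _)
    (Finset.prod_nonneg fun p _ => h0 _ _)
  · refine div_le_div_of_nonneg_right ?_ (Nat.cast_nonneg _)
    dsimp only
    split_ifs
    · exact_mod_cast Finset.card_filter_le _ _
    · exact le_rfl
  · refine div_le_div_of_nonneg_right ?_ (Nat.cast_nonneg _)
    have hpx : p ∣ x := Nat.dvd_of_mem_primeFactors (Finset.mem_sdiff.1 hp).1
    dsimp only
    rw [if_pos hpx]
    have h1 : ((W p).filter (fun r => r ∈ Z p (Fin.last t))).card ≤ 1 :=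
      (Finset.card_le_card fun r hr => (Finset.mem_filter.1 hr).2).trans (hZ p hp)
    exact_mod_cast h1

/-- `Λ^{|P ∪ pf x|} (∏_{pf x ∖ P} 1/p) = Λ^{|P|} · (Λ^{#(pf x ∖ P)} ∏_{pf x ∖ P} 1/p)`. [folklore] -/
theorem pow_card_union_mul (P : Finset ℕ) (x : ℕ) (L : ℝ) :
    L ^ (P ∪ x.primeFactors).card * ∏ p ∈ x.primeFactors \ P, (1 : ℝ) / p =
      L ^ P.card * (L ^ (x.primeFactors \ P).card * ∏ p ∈ x.primeFactors \ P, (1 : ℝ) / p) := by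
  rw [card_union_primeFactors, pow_add, mul_assoc]

end TSSInd

/-! ### The registered sub-goal of this file: the sum of the frozen weights -/

open Literature.NumberTheory.Sieve Literature.NumberTheory.LFunctions in
/-- **The divisor-type sum carrying the inner error terms** (sub-goal `tssI_sum_frozen_weights` of
`stub_tssInduction`): for a finite set `F`, a natural `Λ` and `N ≥ 2`,
`∑_{x ≤ N} |μ(x)| Λ^{#(pf x ∖ F)} ∏_{p ∣ x, p ∉ F} 1/p ≤ 2^{|F|} e^{4Λ} (log N)^Λ`:
the summand is a nonnegative multiplicative function summed under its Euler product `∏_{p ≤ N}(1 + φ_p)`,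
`φ_p = 1` on `F` and `Λ/p` off `F`, and `∑_{p ≤ N} 1/p ≤ log log N + 4` (Mertens). [cite: HardyWright2008, Thm 427] -/
theorem tssI_sum_frozen_weights : ∀ (F : Finset ℕ) (Lam N : ℕ), 2 ≤ N →
    ∑ x ∈ Finset.Icc 1 N, |((ArithmeticFunction.moebius x : ℤ) : ℝ)| *
        ((Lam : ℝ) ^ (x.primeFactors \ F).card * ∏ p ∈ x.primeFactors \ F, (1 : ℝ) / p) ≤
      2 ^ F.card * (Real.exp (4 * Lam) * Real.log N ^ Lam) := by
  intro F Lam N hN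
  -- the local weights
  set φ : ℕ → ℝ := fun p => if p ∈ F then (1 : ℝ) else (Lam : ℝ) * (1 / p) with hφ
  have hφ0 : ∀ p, 0 ≤ φ p := fun p => by
    simp only [hφ]
    split_ifs
    · norm_num
    · positivity
  -- the multiplicative function `f = μ² ∏ φ`
  set f : ArithmeticFunction ℝ := ArithmeticFunction.pmul
    (ArithmeticFunction.pmul (μ : ArithmeticFunction ℝ) (μ : ArithmeticFunction ℝ)) (prodPrimeFactors φ) with hf
  have hfm : IsMultiplicative f :=
    (isMultiplicative_moebius.intCast.pmul isMultiplicative_moebius.intCast).pmul (IsMultiplicative.prodPrimeFactors _)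
  have hfapply : ∀ n, n ≠ 0 → f n = (μ n : ℝ) * (μ n : ℝ) * ∏ p ∈ n.primeFactors, φ p := fun n hn => by
    rw [hf, pmul_apply, pmul_apply, intCoe_apply, prodPrimeFactors_apply hn]
  have hf0 : ∀ n, 0 ≤ f n := fun n => by
    rcases Nat.eq_zero_or_pos n with rfl | hn
    · simp
    · rw [hfapply n hn.ne']
      exact mul_nonneg (mul_self_nonneg _) (Finset.prod_nonneg fun p _ => hφ0 p)
  -- the summand is `f`
  have hsummand : ∀ x ∈ Finset.Icc 1 N, |((μ x : ℤ) : ℝ)| *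
      ((Lam : ℝ) ^ (x.primeFactors \ F).card * ∏ p ∈ x.primeFactors \ F, (1 : ℝ) / p) = f x := by
    intro x hx
    have hx0 : x ≠ 0 := by have := (Finset.mem_Icc.1 hx).1; omega
    rw [hfapply x hx0]
    have hmu : |((μ x : ℤ) : ℝ)| = (μ x : ℝ) * (μ x : ℝ) := by
      rcases eq_or_ne (μ x) 0 with h | h
      · rw [h]; simp
      · rcases moebius_ne_zero_iff_eq_or.1 h with h | h <;> rw [h] <;> simp
    rw [hmu]
    congr 1
    have h1 : ∏ p ∈ x.primeFactors, φ p = ∏ p ∈ x.primeFactors \ F, (Lam : ℝ) * (1 / p) := by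
      rw [Finset.sdiff_eq_filter, Finset.prod_filter]
      refine Finset.prod_congr rfl fun p _ => ?_
      simp only [hφ]
      by_cases hp : p ∈ F
      · rw [if_pos hp, if_neg (not_not_intro hp)]
      · rw [if_neg hp, if_pos hp]
    rw [h1, Finset.prod_mul_distrib, Finset.prod_const]
  rw [Finset.sum_congr rfl hsummand]
  -- Euler product bound
  refine (SquarefreeSums.sum_le_prod_sum_prime_pow hfm hf0 N).trans ?_
  have hloc : ∀ p ∈ Nat.primesBelow (N + 1), ∑ j ∈ Finset.range (N + 1), f (p ^ j) = 1 + φ p := by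
    intro p hp
    have hpp : p.Prime := (Nat.mem_primesBelow.1 hp).2
    obtain ⟨M, hM⟩ : ∃ M, N + 1 = M + 1 + 1 := ⟨N - 1, by omega⟩
    rw [hM, Finset.sum_range_succ', Finset.sum_range_succ', pow_zero, pow_one, hfm.map_one]
    rw [Finset.sum_eq_zero (fun j _ => by
      rw [hfapply _ (pow_ne_zero _ hpp.ne_zero), moebius_apply_prime_pow hpp (by omega : j + 1 + 1 ≠ 0),
        if_neg (by omega)]
      simp), zero_add, hfapply p hpp.ne_zero, moebius_apply_prime hpp, hpp.primeFactors, Finset.prod_singleton]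
    push_cast
    ring
  rw [Finset.prod_congr rfl hloc]
  -- `1 + φ p ≤ 2^{[p ∈ F]} (1 + Λ/p)`
  have hfac : ∀ p ∈ Nat.primesBelow (N + 1), 1 + φ p ≤ (if p ∈ F then (2 : ℝ) else 1) * (1 + (Lam : ℝ) / p) := by
    intro p _
    have hL : (0 : ℝ) ≤ (Lam : ℝ) / p := by positivity
    simp only [hφ]
    by_cases hF : p ∈ F
    · rw [if_pos hF, if_pos hF]
      linarith
    · rw [if_neg hF, if_neg hF, one_mul, mul_one_div]
  refine (Finset.prod_le_prod (fun p _ => by linarith [hφ0 p]) hfac).trans ?_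
  rw [Finset.prod_mul_distrib]
  have hA : ∏ p ∈ Nat.primesBelow (N + 1), (if p ∈ F then (2 : ℝ) else 1) ≤ 2 ^ F.card := by
    rw [Finset.prod_ite, Finset.prod_const_one, mul_one, Finset.prod_const]
    exact pow_le_pow_right₀ (by norm_num) (Finset.card_le_card fun p hp => (Finset.mem_filter.1 hp).2)
  have hC : ∏ p ∈ Nat.primesBelow (N + 1), (1 + (Lam : ℝ) / p) ≤ Real.exp (4 * Lam) * Real.log N ^ Lam := by
    refine (SquarefreeSums.prod_one_add_le_exp_sum fun p _ => by positivity).trans ?_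
    have hsum : ∑ p ∈ Nat.primesBelow (N + 1), (Lam : ℝ) / p ≤ Lam * (Real.log (Real.log N) + 4) := by
      rw [show ∑ p ∈ Nat.primesBelow (N + 1), (Lam : ℝ) / p = Lam * ∑ p ∈ Nat.primesLE N, (1 : ℝ) / p by
        rw [Finset.mul_sum]
        exact Finset.sum_congr rfl fun p _ => by rw [mul_one_div]]
      exact mul_le_mul_of_nonneg_left (MertensBound.sum_inv_prime_le N hN) (Nat.cast_nonneg _)
    refine (Real.exp_le_exp.2 hsum).trans (le_of_eq ?_)
    have hlogN : 0 < Real.log N := Real.log_pos (by exact_mod_cast hN)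
    rw [mul_add, Real.exp_add, mul_comm (Lam : ℝ) 4, ← Real.exp_log hlogN, ← Real.exp_nat_mul, Real.exp_log hlogN]
    ring
  have hA0 : 0 ≤ ∏ p ∈ Nat.primesBelow (N + 1), (if p ∈ F then (2 : ℝ) else 1) :=
    Finset.prod_nonneg fun p _ => by split_ifs <;> norm_num
  have hC0 : 0 ≤ ∏ p ∈ Nat.primesBelow (N + 1), (1 + (Lam : ℝ) / p) := Finset.prod_nonneg fun p _ => by positivity
  exact mul_le_mul hA hC hC0 (by positivity)

end Summit.Parity.GeneralizedHardyLittlewood.Cruxes.RelativeDimOne.SingleMoebiusSplit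

end
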